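import Summits.ResolutionOfSingularities.ResolutionOfSingularities.Theorems.WeightedInvariantTieFiniteInChart
import Summits.ResolutionOfSingularities.ResolutionOfSingularities.Theorems.WeightedInvariantTieFinitePointwise
import HarnessLib

/-!
# Finiteness of the tie points — two chart prelims for the scheme corollary: the generic local ring of the tie curve has
# dimension two, and the lex-maximal datum descends from `(A_𝔮)_{P₀}` to `A_P` (door `HypersurfaceCentreConstruction`,
# stmt-ResolutionOfSingularities-19897, route `WeightedInvariant`, P3 rung `KeyRungGrLE 3 p`, clause (c8)≤3,p for the letter `τ`)

[OURS · L1 W4.3 · cell `res-hironaka`, HUMAN RULING D-0089] Helper file `--supports stmt-ResolutionOfSingularities-19897` (line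
`local-engine` of res-L1-w43-plan-1, spec `L/res-type-047/D2-INCHART-SPEC-v3.md` steps (S2)/(S3)).
* `TieFinite.IsTiePosition.ringKrullDim_localization_topStratumPrime_eq_two` — at a tie position `(S, g)` (`S` regular local of
  dimension `3`, `P₀` the stratum prime): `dim S_{P₀} = 2` (`≥ 2` is `IsTiePosition.two_le_ringKrullDim_localization`, p540078; `≤ 2` since
  `P₀ < 𝔪`, `ht 𝔪 = 3`).  This is the binder `hdimP` of `TieFinite.finite_tiePrimes` (p548769) read at `A_P ≅ (𝒪_z)_{P₀}`.
* `TieFinite.isLexMax_of_localization_localization` — the INVERSE direction of `isLexMax_localization_localization` (p548769): a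
  lex-maximal datum at `(A_𝔮)_{P₀}` (`P₀` a prime of `A_𝔮` over `P`) for `(f/1/1; U/1/1)` IS a lex-maximal datum at `A_P` for `(f/1; U/1)` —
  step (S3): the tie presentation of `z` is read in `𝒪_z ≅ A_{𝔮_z}`, its lex-max clause at `(A_{𝔮_z})_{P₀}`, and `finite_tiePrimes` wants it at `A_P`.

[OURS] Replaces the role of NO printed item; NOT a statement of the manuscript under review [claim: Hironaka2017, status:
under-review].  AI work, weaker than expert review.  Def-free.

## References

* H. Matsumura, *Commutative Ring Theory*, §5 (height and dimension under localisation). [Matsumura1987]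
* D. Abramovich, M. H. Quek, B. Schober, arXiv:2507.01232 (v3, 2026), Thm 3.5. [AbramovichQuekSchober2025]
-/

noncomputable section

set_option linter.dupNamespace false -- mandated namespace `Summit.<Summit>.<Problem>` of this single-conjunct summit

open IsLocalRing Literature.AlgebraicGeometry.Resolution
open Summit.ResolutionOfSingularities.ResolutionOfSingularities.Theorems

namespace Summit.ResolutionOfSingularities.ResolutionOfSingularities.Cruxes.HypersurfaceCentreConstruction.LocalEngine

namespace TieFinite

/-! ## The generic local ring of the tie curve has dimension two -/

section DimTwo

variable {S : Type} [CommRing S]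

/-- **`dim S_{P₀} = 2` at a tie position.** [cite: Matsumura1987, §5] -/
theorem IsTiePosition.ringKrullDim_localization_topStratumPrime_eq_two {g : S} (hz : Iota3.IsTiePosition S g)
    [(ContactCylinder.topStratumPrime Iota3.iotaOrdEps S g).IsPrime] :
    ringKrullDim (Localization.AtPrime (ContactCylinder.topStratumPrime Iota3.iotaOrdEps S g)) = 2 := by
  haveI := hz.1
  refine le_antisymm ?_ (IsTiePosition.two_le_ringKrullDim_localization hz)
  obtain ⟨_, hdim, -, -, x, y, z, q, r, lam, hpres⟩ := hz
  have hP₀ : ContactCylinder.topStratumPrime Iota3.iotaOrdEps S g = Ideal.span {x, y} := hpres.2.1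
  -- `P₀ < 𝔪`
  have hlt : ContactCylinder.topStratumPrime Iota3.iotaOrdEps S g < maximalIdeal S := by
    refine lt_of_le_of_ne (IsLocalRing.le_maximalIdeal Ideal.IsPrime.ne_top') ?_
    rw [hP₀]
    exact (maximalIdeal_ne_span_pair hdim x y).symm
  -- `ht P₀ + 1 ≤ ht 𝔪 = 3`
  have h := Ideal.height_add_one_le_of_lt_of_isPrime hlt
  have h𝔪 : (maximalIdeal S).height = 3 := by
    have h3 := IsLocalRing.maximalIdeal_height_eq_ringKrullDim (R := S)
    rw [hdim] at h3
    exact WithBot.coe_inj.mp h3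
  rw [h𝔪] at h
  have hP : (ContactCylinder.topStratumPrime Iota3.iotaOrdEps S g).height ≤ 2 := by
    have hne : (ContactCylinder.topStratumPrime Iota3.iotaOrdEps S g).height ≠ ⊤ := by
      intro htop; rw [htop] at h; exact absurd h (by decide)
    obtain ⟨m, hm⟩ := ENat.ne_top_iff_exists.mp hne
    rw [← hm] at h ⊢
    have h3 : m + 1 ≤ 3 := by exact_mod_cast h
    exact_mod_cast (show m ≤ 2 by omega)
  rw [IsLocalization.AtPrime.ringKrullDim_eq_height (ContactCylinder.topStratumPrime Iota3.iotaOrdEps S g)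
    (Localization.AtPrime (ContactCylinder.topStratumPrime Iota3.iotaOrdEps S g))]
  exact WithBot.coe_le_coe.mpr hP

end DimTwo

/-! ## The lex-maximal datum descends from `(A_𝔮)_{P₀}` to `A_P` -/

section Descend

variable {A : Type} [CommRing A]

/-- **Descent of the lex-maximal datum along `A_P ≃ (A_𝔮)_{P₀}`** (`P₀` a prime of `A_𝔮` over `P`): the inverse direction of
`isLexMax_localization_localization`. [cite: AbramovichQuekSchober2025, Thm 3.5] -/
theorem isLexMax_of_localization_localization (𝔮 : Ideal A) [𝔮.IsPrime] (P₀ : Ideal (Localization.AtPrime 𝔮)) [P₀.IsPrime]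
    (P : Ideal A) [P.IsPrime] (hP₀ : P₀.comap (algebraMap A (Localization.AtPrime 𝔮)) = P)
    {f : A} {U : Fin 2 → A} {w : Fin 2 → ℕ} {ℓ : ℕ}
    (hlex : IsLexMaxWeightedCentreGerm (Localization.AtPrime P₀)
      (Ideal.span {algebraMap (Localization.AtPrime 𝔮) (Localization.AtPrime P₀) (algebraMap A (Localization.AtPrime 𝔮) f)})
      (fun i => algebraMap (Localization.AtPrime 𝔮) (Localization.AtPrime P₀) (algebraMap A (Localization.AtPrime 𝔮) (U i)))
      w ℓ) :
    IsLexMaxWeightedCentreGerm (Localization.AtPrime P) (Ideal.span {algebraMap A (Localization.AtPrime P) f})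
      (fun i => algebraMap A (Localization.AtPrime P) (U i)) w ℓ := by
  subst hP₀
  have h := LexMaxCentre.map_ringEquiv hlex
    (IsLocalization.localizationLocalizationAtPrimeIsoLocalization 𝔮.primeCompl P₀).toRingEquiv.symm
  have he : ∀ a : A, (IsLocalization.localizationLocalizationAtPrimeIsoLocalization 𝔮.primeCompl P₀).toRingEquiv.symm
      (algebraMap (Localization.AtPrime 𝔮) (Localization.AtPrime P₀) (algebraMap A _ a)) = algebraMap A _ a := fun a => by
    rw [RingEquiv.symm_apply_eq, AlgEquiv.coe_ringEquiv, ← IsScalarTower.algebraMap_apply A (Localization.AtPrime 𝔮)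
      (Localization.AtPrime P₀), AlgEquiv.commutes]
  rw [Ideal.map_span, Set.image_singleton, RingEquiv.coe_toRingHom, he] at h
  simp only [he] at h
  exact h

end Descend

end TieFinite

end Summit.ResolutionOfSingularities.ResolutionOfSingularities.Cruxes.HypersurfaceCentreConstruction.LocalEngine

end
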